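import Literature.MathematicalPhysics.QuantumLattice.TIVariationalPressure
import Literature.MathematicalPhysics.QuantumLattice.InfVolFermionStateRegionEntropy
import Literature.InformationTheory.Entropy.VonNeumannEntropyConcavity
import HarnessLib

/-!
# THE MEAN ENTROPY OF A TRANSLATION-INVARIANT LATTICE-FERMION STATE EXISTS:
# `S(ω|_{[0,n)^d})/n^d → s̄(ω) = inf_m S(ω|_{[0,m)^d})/m^d`, with the finite-box caps
# `S(ω|_{[0,n)^d})/n^d ≤ S(ω|_{[0,m)^d})/m^d + d·m·log 4/n`; `s̄` is AFFINE, and equilibrium states form a FACE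

Topic `Literature/MathematicalPhysics/QuantumLattice` (family `hubbard`; crew hubbard-fast S2 «T > 0»). `TIVariationalPressure` works with the
UPPER entropy density `s̄(ω) = limsup_n S(ω|_{[0,n)^d})/n^d` «so that no existence theorem for the mean entropy is needed». This file supplies
the existence theorem (Araki–Moriya §10 / Bratteli–Robinson Prop. 6.2.38 for the CAR algebra), by box subadditivity of the entropy of even
states (`FermionBoxSubadditivity`) and the translation invariance of box entropies (`InfVolFermionStateRegionEntropy`):

* §1 **Box tilings**: the `k^d` translates `m·j + [0,m)^d`, `j ∈ [0,k)^d`, are disjoint sub-boxes of `[0,n)^d` when `km ≤ n`.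
* §2 **Subadditivity over the tiling**: for a translation-invariant `ω` on `ℤ^d` (`d ≥ 1`), `m ≥ 1` and every `n`
  (`k = ⌊n/m⌋`): `S(ω|_{[0,n)^d}) ≤ k^d·S(ω|_{[0,m)^d}) + (n^d − k^d m^d)·log 4`
  (`IsTranslationInvariant.vonNeumannEntropy_rdm_halfOpenBox_le_tiling`), hence the EXPLICIT FINITE-BOX CAP
  **`S(ω|_{[0,n)^d})/n^d ≤ S(ω|_{[0,m)^d})/m^d + d·m·log 4/n`** for `n ≥ 1` (`…boxEntropyDensity_le_add`).
* §3 **Existence of the mean entropy**: `s̄(ω) ≤ S(ω|_{[0,m)^d})/m^d` for every `m ≥ 1` (`…entropyDensitySup_le_boxEntropyDensity` — ONE box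
  caps the entropy density of a translation-invariant state), `s̄` is the greatest lower bound of the box densities (`…isGLB_entropyDensitySup`),
  and **`S(ω|_{[0,n)^d})/n^d → s̄(ω)`** (`…tendsto_boxEntropyDensity`): `entropyDensitySup` IS Araki–Moriya's mean entropy `s(ω)`.
* §4 **`s̄` is AFFINE on translation-invariant states**: `s̄(λω₁ + (1−λ)ω₂) = λ s̄(ω₁) + (1−λ) s̄(ω₂)` (`entropyDensitySup_mix`; concavity of
  `S` and the mixing bound `+log 2` per box, divided by `n^d`).
* §5 **Consequences for the variational pressure** (any finite-range interaction, any `β`): the variational functional `s̄ − βe_Ψ` is affine, so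
  mixtures of equilibrium states are equilibrium states (`IsVarEquilibrium.mix`) and, conversely, **both components of an equilibrium mixture
  are equilibrium states** (`IsVarEquilibrium.of_mix_left/right` — the equilibrium states form a FACE of the simplex of invariant states:
  the phases of a coexisting thermal state are thermal phases, for every model); and the finite-box reading of pressure caps
  (`varPressure_le_of_boxEntropy`: a bound on `S(ω|_{[0,m)^d})/m^d − βe_Ψ(ω)` uniform over invariant `ω` caps `P(β,Ψ)`).

Everything is PROVED; no definition, no named fact, no number.

## Mathlib / tree search

REUSED: `boxEntropyDensity(_apply/_nonneg/_le)`, `entropyDensitySup`, `entropyDensitySup_le_of_eventually`, `le_entropyDensitySup_of_eventually`,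
`varPressure_le`, `sub_mul_le_varPressure`, `IsVarEquilibrium` (`TIVariationalPressure`); `IsTranslationInvariant.vonNeumannEntropy_rdm_shiftSet`,
`regionEntropy_rdm` (`InfVolFermionStateRegionEntropy`); `vonNeumannEntropy_le_sum_regionEntropy_add` (`FermionBoxSubadditivity`); `rdm_mix`,
`vonNeumannEntropy_rdm_mix_le` (`HubbardTTPrimeThermalPhaseCoexistence`); `vonNeumannEntropy_convexComb_two_ge` (`VonNeumannEntropyConcavity`);
`meanEnergy_mix`, `IsTranslationInvariant.mix`, `IsTranslationInvariant.isEven`, `shiftSet`, `mem_shiftSet`, `halfOpenBox`, `card_halfOpenBox`;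
Mathlib `one_add_mul_le_pow` (Bernoulli), `Nat.lt_div_mul_add`, `Filter.eventually_lt_of_limsup_lt`, `tendsto_order`, `tendsto_const_div_atTop_nhds_zero_nat`.
`lean search 'tendsto.*boxEntropyDensity|mean entropy exists|entropyDensitySup_mix'` (2026-08-28): nothing.

## References

* H. Araki, H. Moriya, Rev. Math. Phys. 15 (2003) 93–198, §10 (mean entropy of translation-invariant states of the Fermion algebra:
  existence as an infimum over boxes, affinity). [cite: ArakiMoriya2003, Theorem 3.8 and §10]
* O. Bratteli, D. W. Robinson, *OAQSM 2* (1997), Prop. 6.2.38 (mean entropy: existence, `s = inf`, affinity, upper semicontinuity),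
  Thm. 6.2.40. [cite: BratteliRobinsonII1997, Thm. 6.2.40]
* R. B. Israel, *Convexity in the Theory of Lattice Gases* (1979), Thm. I.2.4 (equilibrium states as a face / tangent functionals).
  [cite: Israel1979, Thm. I.2.4]
* M. A. Nielsen, I. L. Chuang, *QCQI* (2010), Thm. 11.10 (concavity; mixing bound). [cite: NielsenChuang2010, Theorem 11.10 eq. (11.88) p.518]
-/

noncomputable section

open scoped ComplexOrder BigOperators
open Finset Literature.InformationTheory.Entropy

namespace Literature.MathematicalPhysics.QuantumLattice

open Matrix HubbardWave0 Literature.Probability.LatticeModels ThermodynamicLimit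
open Literature.Computability.QuantumComplexity (IsDensity)
open _root_.Filter
open scoped _root_.Topology

namespace InfVolFermionState

variable {d : ℕ}

/-! ### §1 Box tilings -/

/-- Membership in the translate `m·j + [0,m)^d`. [cite: FriedliVelenik2017, §3.2] -/
theorem mem_shiftSet_smul_halfOpenBox {m : ℕ} {j x : Site d} :
    x ∈ shiftSet ((m : ℤ) • j) (halfOpenBox d m) ↔ ∀ i, (m : ℤ) * j i ≤ x i ∧ x i < (m : ℤ) * j i + m := by
  rw [mem_shiftSet, mem_halfOpenBox]
  refine forall_congr' fun i => ?_
  simp only [Pi.sub_apply, Pi.smul_apply, smul_eq_mul]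
  constructor
  · rintro ⟨h1, h2⟩; constructor <;> omega
  · rintro ⟨h1, h2⟩; constructor <;> omega

/-- **The sub-boxes lie in the big box**: `m·j + [0,m)^d ⊆ [0,n)^d` for `j ∈ [0,k)^d` and `km ≤ n`. [cite: FriedliVelenik2017, §3.2] -/
theorem shiftSet_smul_halfOpenBox_subset {m k n : ℕ} (hkm : k * m ≤ n) {j : Site d} (hj : j ∈ halfOpenBox d k) :
    shiftSet ((m : ℤ) • j) (halfOpenBox d m) ⊆ halfOpenBox d n := by
  intro x hx
  rw [mem_shiftSet_smul_halfOpenBox] at hx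
  rw [mem_halfOpenBox] at hj ⊢
  intro i
  obtain ⟨h1, h2⟩ := hx i
  obtain ⟨hj1, hj2⟩ := hj i
  have hkm' : ((k : ℤ)) * m ≤ n := by exact_mod_cast hkm
  have hji : j i + 1 ≤ k := by omega
  have hm0 : (0 : ℤ) ≤ m := Int.natCast_nonneg m
  constructor
  · nlinarith
  · have : (m : ℤ) * j i + m ≤ (m : ℤ) * k := by nlinarith
    linarith

/-- **Distinct sub-boxes are disjoint** (`m ≥ 1`). [cite: FriedliVelenik2017, §3.2] -/
theorem disjoint_shiftSet_smul_halfOpenBox {m : ℕ} (hm : 1 ≤ m) {j j' : Site d} (hjj' : j ≠ j') :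
    Disjoint (shiftSet ((m : ℤ) • j) (halfOpenBox d m)) (shiftSet ((m : ℤ) • j') (halfOpenBox d m)) := by
  rw [Finset.disjoint_left]
  intro x hx hx'
  rw [mem_shiftSet_smul_halfOpenBox] at hx hx'
  apply hjj'
  funext i
  obtain ⟨h1, h2⟩ := hx i
  obtain ⟨h1', h2'⟩ := hx' i
  have hm' : (0 : ℤ) < m := by exact_mod_cast hm
  have a : (m : ℤ) * j i < (m : ℤ) * (j' i + 1) := by nlinarith
  have b : (m : ℤ) * j' i < (m : ℤ) * (j i + 1) := by nlinarith
  have a' := lt_of_mul_lt_mul_left a hm'.le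
  have b' := lt_of_mul_lt_mul_left b hm'.le
  omega

/-- Each sub-box has `m^d` sites. [cite: FriedliVelenik2017, §3.2] -/
theorem card_shiftSet_halfOpenBox (v : Site d) (m : ℕ) : (shiftSet v (halfOpenBox d m)).card = m ^ d := by
  rw [shiftSet_eq_map, Finset.card_map, card_halfOpenBox]

/-! ### §2 Subadditivity over the tiling -/

/-- **SUBADDITIVITY OVER A BOX TILING**: for a translation-invariant `ω` on `ℤ^d` (`d ≥ 1`), `m ≥ 1`, and `k, n` with `km ≤ n`:
`S(ω|_{[0,n)^d}) ≤ k^d·S(ω|_{[0,m)^d}) + (n^d − k^d m^d)·log 4` (the `k^d` translates of `[0,m)^d` carry the entropy of `[0,m)^d`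
each; every remaining site costs at most `log 4`). [cite: ArakiMoriya2003, Theorem 3.8 and §10] -/
theorem IsTranslationInvariant.vonNeumannEntropy_rdm_halfOpenBox_le_tiling (hd : 0 < d) {ω : InfVolFermionState d}
    (hω : ω.IsTranslationInvariant) {m : ℕ} (hm : 1 ≤ m) {k n : ℕ} (hkm : k * m ≤ n) :
    vonNeumannEntropy (ω.rdm (halfOpenBox d n)) ≤
      (k : ℝ) ^ d * vonNeumannEntropy (ω.rdm (halfOpenBox d m)) + ((n : ℝ) ^ d - (k : ℝ) ^ d * (m : ℝ) ^ d) * Real.log 4 := by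
  have hev : parityAut (ω.rdm (halfOpenBox d n)) = ω.rdm (halfOpenBox d n) := (hω.isEven hd).parityAut_rdm _
  have h := vonNeumannEntropy_le_sum_regionEntropy_add (halfOpenBox d k)
    (fun j : Site d => shiftSet ((m : ℤ) • j) (halfOpenBox d m))
    (fun j hj => shiftSet_smul_halfOpenBox_subset hkm hj) (fun j _ j' _ hjj' => disjoint_shiftSet_smul_halfOpenBox hm hjj')
    (ω.rdm_posSemidef _) (ω.trace_rdm _) hev
  have hsum : ∑ j ∈ halfOpenBox d k, regionEntropy (ω.rdm (halfOpenBox d n)) (shiftSet ((m : ℤ) • j) (halfOpenBox d m)) =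
      (k : ℝ) ^ d * vonNeumannEntropy (ω.rdm (halfOpenBox d m)) := by
    rw [Finset.sum_congr rfl fun j hj => by
      rw [ω.regionEntropy_rdm (shiftSet_smul_halfOpenBox_subset hkm hj), hω.vonNeumannEntropy_rdm_shiftSet],
      Finset.sum_const, card_halfOpenBox, nsmul_eq_mul]
    push_cast
    ring
  have hcard : ((halfOpenBox d n).card : ℝ) - ∑ j ∈ halfOpenBox d k, ((shiftSet ((m : ℤ) • j) (halfOpenBox d m)).card : ℝ) =
      (n : ℝ) ^ d - (k : ℝ) ^ d * (m : ℝ) ^ d := by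
    rw [Finset.sum_congr rfl fun j _ => by rw [card_shiftSet_halfOpenBox], Finset.sum_const, card_halfOpenBox, card_halfOpenBox,
      nsmul_eq_mul]
    push_cast
    ring
  rw [hsum, hcard] at h
  exact h

/-- `1 − x^d ≤ d·(1 − x)` for `0 ≤ x` (Bernoulli). [cite: NielsenChuang2010, §11.3.4] -/
private theorem one_sub_pow_le_mul (x : ℝ) (hx : 0 ≤ x) (d : ℕ) : 1 - x ^ d ≤ d * (1 - x) := by
  have h := one_add_mul_le_pow (a := x - 1) (by linarith) d
  have e : (1 : ℝ) + (x - 1) = x := by ring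
  rw [e] at h
  linarith

/-- **EXPLICIT FINITE-BOX CAP**: for a translation-invariant `ω` on `ℤ^d` (`d ≥ 1`), `m ≥ 1` and every `n ≥ 1`:
`S(ω|_{[0,n)^d})/n^d ≤ S(ω|_{[0,m)^d})/m^d + d·m·log 4/n`. [cite: ArakiMoriya2003, Theorem 3.8 and §10] [cite: BratteliRobinsonII1997, Thm. 6.2.40] -/
theorem IsTranslationInvariant.boxEntropyDensity_le_add (hd : 0 < d) {ω : InfVolFermionState d} (hω : ω.IsTranslationInvariant)
    {m : ℕ} (hm : 1 ≤ m) {n : ℕ} (hn : 1 ≤ n) :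
    ω.boxEntropyDensity n ≤ ω.boxEntropyDensity m + d * m * Real.log 4 / n := by
  have hkm : n / m * m ≤ n := Nat.div_mul_le_self n m
  have hlt : n < n / m * m + m := Nat.lt_div_mul_add (by omega)
  have h := hω.vonNeumannEntropy_rdm_halfOpenBox_le_tiling hd hm hkm
  have hn0 : (0 : ℝ) < n := by exact_mod_cast hn
  have hm0 : (0 : ℝ) < m := by exact_mod_cast hm
  have hnd : (0 : ℝ) < (n : ℝ) ^ d := by positivity
  have hmd : (0 : ℝ) < (m : ℝ) ^ d := by positivity
  -- the ratio `x = km/n ∈ [0,1]`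
  set x : ℝ := ((n / m : ℕ) : ℝ) * m / n with hx
  have hx0 : 0 ≤ x := by positivity
  have hx1 : x ≤ 1 := by
    rw [hx, div_le_one hn0]; exact_mod_cast hkm
  have h1x : 1 - x ≤ (m : ℝ) / n := by
    rw [hx, sub_le_iff_le_add, ← add_div, le_div_iff₀ hn0, one_mul]
    have : ((n : ℕ) : ℝ) ≤ (((n / m) * m + m : ℕ) : ℝ) := by exact_mod_cast hlt.le
    push_cast at this
    linarith
  have hxd : ((n / m : ℕ) : ℝ) ^ d * (m : ℝ) ^ d = x ^ d * (n : ℝ) ^ d := by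
    rw [hx, div_pow, mul_pow, div_mul_cancel₀ _ (ne_of_gt hnd)]
  set S := vonNeumannEntropy (ω.rdm (halfOpenBox d m)) with hS
  have hS0 : 0 ≤ S := vonNeumannEntropy_nonneg (ω.rdm_posSemidef _) (ω.trace_rdm _)
  have hlog4 : 0 ≤ Real.log 4 := Real.log_nonneg (by norm_num)
  rw [boxEntropyDensity_apply, boxEntropyDensity_apply, div_le_iff₀ hnd]
  -- `S(n) ≤ x^d n^d S/m^d + (1 − x^d) n^d log 4 ≤ n^d S/m^d + d (m/n) n^d log 4`
  have e1 : ((n / m : ℕ) : ℝ) ^ d * S = x ^ d * ((n : ℝ) ^ d * (S / (m : ℝ) ^ d)) := by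
    rw [← mul_assoc, ← hxd]; field_simp
  have hxd1 : x ^ d ≤ 1 := pow_le_one₀ hx0 hx1
  have hbern := one_sub_pow_le_mul x hx0 d
  have hC : 0 ≤ (n : ℝ) ^ d * (S / (m : ℝ) ^ d) := mul_nonneg hnd.le (div_nonneg hS0 hmd.le)
  have h3 : x ^ d * ((n : ℝ) ^ d * (S / (m : ℝ) ^ d)) ≤ (n : ℝ) ^ d * (S / (m : ℝ) ^ d) := mul_le_of_le_one_left hC hxd1
  have h2 : ((n : ℝ) ^ d - ((n / m : ℕ) : ℝ) ^ d * (m : ℝ) ^ d) * Real.log 4 ≤ (d * m * Real.log 4 / n) * (n : ℝ) ^ d := by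
    rw [hxd]
    have e : ((n : ℝ) ^ d - x ^ d * (n : ℝ) ^ d) = (1 - x ^ d) * (n : ℝ) ^ d := by ring
    rw [e]
    have h4 : (1 - x ^ d) ≤ d * ((m : ℝ) / n) := hbern.trans (mul_le_mul_of_nonneg_left h1x (Nat.cast_nonneg d))
    have h5 : (1 - x ^ d) * (n : ℝ) ^ d * Real.log 4 ≤ d * ((m : ℝ) / n) * (n : ℝ) ^ d * Real.log 4 :=
      mul_le_mul_of_nonneg_right (mul_le_mul_of_nonneg_right h4 hnd.le) hlog4
    have e' : d * m * Real.log 4 / n * (n : ℝ) ^ d = d * ((m : ℝ) / n) * (n : ℝ) ^ d * Real.log 4 := by ring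
    rw [e']
    exact h5
  rw [e1] at h
  have e2 : (S / (m : ℝ) ^ d + d * m * Real.log 4 / n) * (n : ℝ) ^ d =
      (n : ℝ) ^ d * (S / (m : ℝ) ^ d) + d * m * Real.log 4 / n * (n : ℝ) ^ d := by
    ring
  rw [e2]
  linarith

/-! ### §3 Existence of the mean entropy -/

/-- **ONE BOX CAPS THE ENTROPY DENSITY**: `s̄(ω) ≤ S(ω|_{[0,m)^d})/m^d` for every translation-invariant `ω` (`d ≥ 1`) and every `m ≥ 1`.
[cite: ArakiMoriya2003, Theorem 3.8 and §10] [cite: BratteliRobinsonII1997, Thm. 6.2.40] -/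
theorem IsTranslationInvariant.entropyDensitySup_le_boxEntropyDensity (hd : 0 < d) {ω : InfVolFermionState d}
    (hω : ω.IsTranslationInvariant) {m : ℕ} (hm : 1 ≤ m) :
    ω.entropyDensitySup ≤ ω.boxEntropyDensity m := by
  refine ω.entropyDensitySup_le_of_eventually fun ε hε => ?_
  have hlim : Tendsto (fun n : ℕ => (d : ℝ) * m * Real.log 4 / n) atTop (𝓝 0) := tendsto_const_div_atTop_nhds_zero_nat _
  filter_upwards [Filter.eventually_ge_atTop 1, (tendsto_order.1 hlim).2 ε hε] with n hn hnε
  have h := hω.boxEntropyDensity_le_add hd hm hn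
  rw [← boxEntropyDensity_apply]
  linarith

/-- **`s̄(ω)` is the greatest lower bound of the box entropy densities `S(ω|_{[0,m)^d})/m^d`, `m ≥ 1`.**
[cite: BratteliRobinsonII1997, Thm. 6.2.40] -/
theorem IsTranslationInvariant.isGLB_entropyDensitySup (hd : 0 < d) {ω : InfVolFermionState d} (hω : ω.IsTranslationInvariant) :
    IsGLB (Set.range fun m : ℕ => ω.boxEntropyDensity (m + 1)) ω.entropyDensitySup := by
  constructor
  · rintro _ ⟨m, rfl⟩
    exact hω.entropyDensitySup_le_boxEntropyDensity hd (Nat.succ_pos m)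
  · intro a ha
    refine ω.le_entropyDensitySup_of_eventually ?_
    filter_upwards [Filter.eventually_ge_atTop 1] with n hn
    have h : a ≤ ω.boxEntropyDensity (n - 1 + 1) := ha ⟨n - 1, rfl⟩
    rw [Nat.sub_add_cancel hn, boxEntropyDensity_apply] at h
    exact h

/-- **THE MEAN ENTROPY EXISTS**: `S(ω|_{[0,n)^d})/n^d → s̄(ω)` for every translation-invariant state of the lattice fermions on `ℤ^d`,
`d ≥ 1` — `entropyDensitySup` is the mean entropy `s(ω)`. [cite: ArakiMoriya2003, Theorem 3.8 and §10] [cite: BratteliRobinsonII1997, Thm. 6.2.40] -/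
theorem IsTranslationInvariant.tendsto_boxEntropyDensity (hd : 0 < d) {ω : InfVolFermionState d} (hω : ω.IsTranslationInvariant) :
    Tendsto ω.boxEntropyDensity atTop (𝓝 ω.entropyDensitySup) := by
  rw [tendsto_order]
  constructor
  · intro a ha
    filter_upwards [Filter.eventually_ge_atTop 1] with n hn
    exact lt_of_lt_of_le ha (hω.entropyDensitySup_le_boxEntropyDensity hd hn)
  · intro b hb
    have hbd : IsBoundedUnder (· ≤ ·) atTop ω.boxEntropyDensity :=
      isBoundedUnder_of ⟨2 * Real.log 2, fun ℓ => ω.boxEntropyDensity_le ℓ⟩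
    exact Filter.eventually_lt_of_limsup_lt hb hbd

/-- The same limit for the un-normalised notation: `S(ω|_{[0,n)^d})/n^d → s̄(ω)`. [cite: ArakiMoriya2003, Theorem 3.8 and §10] -/
theorem IsTranslationInvariant.tendsto_vonNeumannEntropy_rdm_halfOpenBox_div (hd : 0 < d) {ω : InfVolFermionState d}
    (hω : ω.IsTranslationInvariant) :
    Tendsto (fun n : ℕ => vonNeumannEntropy (ω.rdm (halfOpenBox d n)) / ((n : ℝ) ^ d)) atTop (𝓝 ω.entropyDensitySup) :=
  hω.tendsto_boxEntropyDensity hd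

/-! ### §4 The mean entropy is affine -/

/-- **Concavity per box**: `λ S(ω₁|_Λ) + (1−λ) S(ω₂|_Λ) ≤ S((λω₁ + (1−λ)ω₂)|_Λ)`. [cite: NielsenChuang2010, Theorem 11.10 eq. (11.88) p.518] -/
theorem le_vonNeumannEntropy_rdm_mix (s : ℝ) (hs₀ : 0 ≤ s) (hs₁ : s ≤ 1) (ω₁ ω₂ : InfVolFermionState d) (Λ : Finset (Site d)) :
    s * vonNeumannEntropy (ω₁.rdm Λ) + (1 - s) * vonNeumannEntropy (ω₂.rdm Λ) ≤
      vonNeumannEntropy ((mix s hs₀ hs₁ ω₁ ω₂).rdm Λ) := by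
  have h₁ : IsDensity (ω₁.rdm Λ) := ⟨ω₁.rdm_posSemidef Λ, ω₁.trace_rdm Λ⟩
  have h₂ : IsDensity (ω₂.rdm Λ) := ⟨ω₂.rdm_posSemidef Λ, ω₂.trace_rdm Λ⟩
  have h := vonNeumannEntropy_convexComb_two_ge (t := 1 - s) (by linarith) (by linarith) h₁ h₂
  rw [rdm_mix]
  have e : (((1 - (1 - s) : ℝ)) : ℂ) • ω₁.rdm Λ + (((1 - s : ℝ)) : ℂ) • ω₂.rdm Λ =
      ((s : ℝ) : ℂ) • ω₁.rdm Λ + (((1 - s : ℝ)) : ℂ) • ω₂.rdm Λ := by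
    rw [sub_sub_cancel]
  rw [e, sub_sub_cancel] at h
  exact h

/-- **THE MEAN ENTROPY IS AFFINE**: `s̄(λω₁ + (1−λ)ω₂) = λ s̄(ω₁) + (1−λ) s̄(ω₂)` for translation-invariant `ω₁, ω₂` (`d ≥ 1`).
[cite: ArakiMoriya2003, Theorem 3.8 and §10] [cite: BratteliRobinsonII1997, Thm. 6.2.40] -/
theorem entropyDensitySup_mix (hd : 0 < d) (s : ℝ) (hs₀ : 0 ≤ s) (hs₁ : s ≤ 1) {ω₁ ω₂ : InfVolFermionState d}
    (h₁ : ω₁.IsTranslationInvariant) (h₂ : ω₂.IsTranslationInvariant) :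
    (mix s hs₀ hs₁ ω₁ ω₂).entropyDensitySup = s * ω₁.entropyDensitySup + (1 - s) * ω₂.entropyDensitySup := by
  have hl₁ := h₁.tendsto_boxEntropyDensity hd
  have hl₂ := h₂.tendsto_boxEntropyDensity hd
  refine le_antisymm ?_ ?_
  · -- mixing bound `+ log 2` per box, then the limits of the components
    refine (mix s hs₀ hs₁ ω₁ ω₂).entropyDensitySup_le_of_eventually fun ε hε => ?_
    have hlim0 : Tendsto (fun n : ℕ => Real.log 2 / n) atTop (𝓝 0) := tendsto_const_div_atTop_nhds_zero_nat _
    filter_upwards [Filter.eventually_ge_atTop 1, (tendsto_order.1 hl₁).2 (ω₁.entropyDensitySup + ε / 3) (by linarith),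
      (tendsto_order.1 hl₂).2 (ω₂.entropyDensitySup + ε / 3) (by linarith), (tendsto_order.1 hlim0).2 (ε / 3) (by linarith)]
      with n hn hn₁ hn₂ hn₃
    rw [boxEntropyDensity_apply] at hn₁ hn₂
    have hnd : (0 : ℝ) < (n : ℝ) ^ d := by positivity
    have hmixle := vonNeumannEntropy_rdm_mix_le s hs₀ hs₁ ω₁ ω₂ (halfOpenBox d n)
    have hdiv : vonNeumannEntropy ((mix s hs₀ hs₁ ω₁ ω₂).rdm (halfOpenBox d n)) / (n : ℝ) ^ d ≤
        s * (vonNeumannEntropy (ω₁.rdm (halfOpenBox d n)) / (n : ℝ) ^ d) +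
          (1 - s) * (vonNeumannEntropy (ω₂.rdm (halfOpenBox d n)) / (n : ℝ) ^ d) + Real.log 2 / (n : ℝ) ^ d := by
      rw [mul_div_assoc', mul_div_assoc', ← add_div, ← add_div]
      exact div_le_div_of_nonneg_right hmixle hnd.le
    have hlog : Real.log 2 / (n : ℝ) ^ d ≤ Real.log 2 / n :=
      div_le_div_of_nonneg_left (Real.log_nonneg (by norm_num)) (by exact_mod_cast hn)
        (le_self_pow₀ (by exact_mod_cast hn) (ne_of_gt hd))
    have hs₁' : 0 ≤ 1 - s := by linarith
    nlinarith [mul_le_mul_of_nonneg_left hn₁.le hs₀, mul_le_mul_of_nonneg_left hn₂.le hs₁']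
  · -- concavity per box and `s̄ ≤ S_n/n^d` for the components
    refine (mix s hs₀ hs₁ ω₁ ω₂).le_entropyDensitySup_of_eventually ?_
    filter_upwards [Filter.eventually_ge_atTop 1] with n hn
    have hnd : (0 : ℝ) < (n : ℝ) ^ d := by positivity
    have hconc := le_vonNeumannEntropy_rdm_mix s hs₀ hs₁ ω₁ ω₂ (halfOpenBox d n)
    have hc₁ := h₁.entropyDensitySup_le_boxEntropyDensity hd hn
    have hc₂ := h₂.entropyDensitySup_le_boxEntropyDensity hd hn
    rw [boxEntropyDensity_apply] at hc₁ hc₂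
    have hdiv : s * (vonNeumannEntropy (ω₁.rdm (halfOpenBox d n)) / (n : ℝ) ^ d) +
        (1 - s) * (vonNeumannEntropy (ω₂.rdm (halfOpenBox d n)) / (n : ℝ) ^ d) ≤
          vonNeumannEntropy ((mix s hs₀ hs₁ ω₁ ω₂).rdm (halfOpenBox d n)) / (n : ℝ) ^ d := by
      rw [mul_div_assoc', mul_div_assoc', ← add_div]
      exact div_le_div_of_nonneg_right hconc hnd.le
    have hs₁' : 0 ≤ 1 - s := by linarith
    nlinarith [mul_le_mul_of_nonneg_left hc₁ hs₀, mul_le_mul_of_nonneg_left hc₂ hs₁']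

/-! ### §5 Consequences for the variational pressure: the equilibrium states form a face -/

variable {β : ℝ} {Ψ : FermionInteraction d} {R : ℝ}

/-- **The variational functional is affine**: `(s̄ − βe_Ψ)(λω₁ + (1−λ)ω₂) = λ(s̄ − βe_Ψ)(ω₁) + (1−λ)(s̄ − βe_Ψ)(ω₂)`.
[cite: Israel1979, Thm. I.2.4] -/
theorem varFunctional_mix (hd : 0 < d) (s : ℝ) (hs₀ : 0 ≤ s) (hs₁ : s ≤ 1) {ω₁ ω₂ : InfVolFermionState d}
    (h₁ : ω₁.IsTranslationInvariant) (h₂ : ω₂.IsTranslationInvariant) :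
    (mix s hs₀ hs₁ ω₁ ω₂).entropyDensitySup - β * (mix s hs₀ hs₁ ω₁ ω₂).meanEnergy Ψ R =
      s * (ω₁.entropyDensitySup - β * ω₁.meanEnergy Ψ R) + (1 - s) * (ω₂.entropyDensitySup - β * ω₂.meanEnergy Ψ R) := by
  rw [entropyDensitySup_mix hd s hs₀ hs₁ h₁ h₂, meanEnergy_mix]
  ring

/-- **Mixtures of equilibrium states are equilibrium states.** [cite: Israel1979, Thm. I.2.4] -/
theorem IsVarEquilibrium.mix (hd : 0 < d) (s : ℝ) (hs₀ : 0 ≤ s) (hs₁ : s ≤ 1) {ω₁ ω₂ : InfVolFermionState d}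
    (h₁ : ω₁.IsVarEquilibrium β Ψ R) (h₂ : ω₂.IsVarEquilibrium β Ψ R) :
    (InfVolFermionState.mix s hs₀ hs₁ ω₁ ω₂).IsVarEquilibrium β Ψ R := by
  refine ⟨h₁.1.mix h₂.1 s hs₀ hs₁, ?_⟩
  rw [varFunctional_mix hd s hs₀ hs₁ h₁.1 h₂.1, h₁.2, h₂.2]
  ring

/-- **FACE PROPERTY, left component**: if a non-trivial mixture `λω₁ + (1−λ)ω₂` (`0 < λ`, both components translation invariant) is an
equilibrium state, so is `ω₁` — the phases of a coexisting equilibrium state are equilibrium states, for every model.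
[cite: Israel1979, Thm. I.2.4] [cite: ArakiMoriya2003, Theorem 12.11] -/
theorem IsVarEquilibrium.of_mix_left (hd : 0 < d) {s : ℝ} {hs₀ : 0 ≤ s} {hs₁ : s ≤ 1} (hs : 0 < s)
    {ω₁ ω₂ : InfVolFermionState d} (h₁ : ω₁.IsTranslationInvariant) (h₂ : ω₂.IsTranslationInvariant)
    (h : (InfVolFermionState.mix s hs₀ hs₁ ω₁ ω₂).IsVarEquilibrium β Ψ R) : ω₁.IsVarEquilibrium β Ψ R := by
  refine ⟨h₁, le_antisymm (Ψ.sub_mul_le_varPressure β R h₁) ?_⟩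
  have hmix := h.2
  rw [varFunctional_mix hd s hs₀ hs₁ h₁ h₂] at hmix
  have hb₂ := Ψ.sub_mul_le_varPressure β R h₂
  refine not_lt.1 fun hlt => ?_
  have : s * (ω₁.entropyDensitySup - β * ω₁.meanEnergy Ψ R) + (1 - s) * (ω₂.entropyDensitySup - β * ω₂.meanEnergy Ψ R) <
      s * Ψ.varPressure β R + (1 - s) * Ψ.varPressure β R :=
    add_lt_add_of_lt_of_le (mul_lt_mul_of_pos_left hlt hs) (mul_le_mul_of_nonneg_left hb₂ (by linarith))
  rw [hmix] at this
  linarith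

/-- **FACE PROPERTY, right component** (`λ < 1`). [cite: Israel1979, Thm. I.2.4] [cite: ArakiMoriya2003, Theorem 12.11] -/
theorem IsVarEquilibrium.of_mix_right (hd : 0 < d) {s : ℝ} {hs₀ : 0 ≤ s} {hs₁ : s ≤ 1} (hs : s < 1)
    {ω₁ ω₂ : InfVolFermionState d} (h₁ : ω₁.IsTranslationInvariant) (h₂ : ω₂.IsTranslationInvariant)
    (h : (InfVolFermionState.mix s hs₀ hs₁ ω₁ ω₂).IsVarEquilibrium β Ψ R) : ω₂.IsVarEquilibrium β Ψ R := by
  rw [mix_comm] at h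
  exact IsVarEquilibrium.of_mix_left hd (by linarith) h₂ h₁ h

/-- **Finite-box reading of pressure caps**: a bound `S(ω|_{[0,m)^d})/m^d − βe_Ψ(ω) ≤ c` UNIFORM over translation-invariant `ω`
(one box size `m ≥ 1`) caps the variational pressure: `P(β,Ψ) ≤ c`. [cite: Israel1979, Lemma II.3.1] [cite: ArakiMoriya2003, Theorem 3.8 and §10] -/
theorem varPressure_le_of_boxEntropy (hd : 0 < d) (β : ℝ) (Ψ : FermionInteraction d) (R : ℝ) {m : ℕ} (hm : 1 ≤ m) {c : ℝ}
    (h : ∀ ω : InfVolFermionState d, ω.IsTranslationInvariant → ω.boxEntropyDensity m - β * ω.meanEnergy Ψ R ≤ c) :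
    Ψ.varPressure β R ≤ c :=
  Ψ.varPressure_le β R fun ω hω =>
    (sub_le_sub_right (hω.entropyDensitySup_le_boxEntropyDensity hd hm) _).trans (h ω hω)

end InfVolFermionState

end Literature.MathematicalPhysics.QuantumLattice

end
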